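import Summits.CriticalPhenomena.PercolationContinuityZ3.Theorems.PercNearOneGluingNoHeavyLowerTailSahiSunflowerOnePayer
import Summits.CriticalPhenomena.PercolationContinuityZ3.Theorems.PercNearOneGluingNoHeavyLowerTailSahiSunflowerHubTransfer
import Mathlib.Algebra.BigOperators.Fin
import Mathlib.Tactic.Linarith
import Mathlib.Tactic.Ring
import HarnessLib

/-!
# `NoHeavyLowerTail` (crux stmt-CriticalPhenomena-4575), master-family line P1 (gen 23):
# second-order Harris for sunflowers — the plain DICHOTOMY already gives "the heavier pays", for every `k`

Support file (seat `prim-masterthm-p1`, gen 23; `--supports stmt-CriticalPhenomena-4575`).  Standard axioms, no `sorry`.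
Memo `run/shared/lean/prim/prim-masterthm/FROM-prim-masterthm-p1-g23-*.md`.
SETTING: `…SahiSunflowerOnePayer` (gen 22) typed `SunflowerOnePayer k p` ("if `μ(O) ≤ μ(K)` then `Π μ(U_i) ≤ μ(K)^{k−1}`,
and dually") and derived the plain dichotomy "`Π μ(U_i) ≤ μ(K)^{k−1}` or `Π μ(D_i) ≤ μ(O)^{k−1}`" (`sunflowerOnePayer_dichotomy`);
its memo (§0) calls the heavier-pays form "genuinely sharper" for `k ≥ 4`.  IT IS NOT: the two are EQUIVALENT at every `k`.

THE ARGUMENT.  With cell masses `κ = μ(K)`, `o = μ(O)`, `c_i = μ(U_i ∖ K)` one has `μ(U_i) = κ + c_i`, `μ(D_i) = o + c_i` and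
`κ + o + Σ c_i = 1`.  Put `A(t) := Π_i (t + c_i) − t^k − (Σ c_i) t^{k−1}` — a polynomial in `t` with nonnegative coefficients and
degree `≤ k − 2`, so that `A(t)/t^{k−2}` is ANTITONE on `t > 0` (file `…SahiSunflowerHubTransfer`: `auxA_succ`, `auxA_cross`).  Using `Σ c_i = 1 − κ − o`:
`Π(o + c_i) ≤ o^{k−1} ⟺ A(o) ≤ κ·o^{k−1} ⟺ A(o)/o^{k−2} ≤ κo`, and `Π(κ + c_i) ≤ κ^{k−1} ⟺ A(κ)/κ^{k−2} ≤ κo`.  Hence for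
`0 < o ≤ κ` the outside branch implies the kernel branch (`prod_add_le_pow_of_prod_add_le_pow`), and dually.
(The positivity `0 < o` is needed ALGEBRAICALLY — e.g. `k = 3, o = 0, c = (0, .3, .3), κ = .4` — but not structurally: in a
sunflower `μ(D_i) = 0` forces `μ(U_i ∖ K) = 0`, and deleting member `i` leaves a `(k−1)`-sunflower with the same kernel and outside
`D_i`; this is how the degenerate case is handled in `sunflowerOnePayer_of_dichotomy`.)

RESULTS:
* (`…SahiSunflowerHubTransfer`) `prod_add_le_pow_of_prod_add_le_pow` — the one-variable transfer lemma (pure algebra, `k ≥ 2`).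
* `kernel_branch_of_outside_branch`, `outside_branch_of_kernel_branch` — measure level: for a `k`-sunflower (`k ≥ 2`) with
  `0 < μ(O) ≤ μ(K)`, `Π μ(D_i) ≤ μ(O)^{k−1} ⟹ Π μ(U_i) ≤ μ(K)^{k−1}`; dually for `0 < μ(K) ≤ μ(O)`.
* `sunflowerOnePayer_of_dichotomy` — **if every `j`-sunflower with `2 ≤ j ≤ k` satisfies the plain dichotomy then
  `SunflowerOnePayer k p`**; with `sunflowerOnePayer_dichotomy`: `sunflowerOnePayer_all_iff_dichotomy_all`
  (`(∀ k, SunflowerOnePayer k p) ↔` the dichotomy for all `k`).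
Consequently the typed conjecture may be read as the bare disjunction "kernel pays or outside pays"; in the max-form it is the
single symmetric inequality `Π_i max(μ(U_i), μ(D_i)) ≤ max(μ(K), μ(O))^{k−1}`.
HONEST FRAMING: elementary equivalences; `SunflowerOnePayer k p` itself (`k ≥ 3`, = S₃^max at `k = 3`) remains OPEN.
[this work]
-/

noncomputable section

open scoped Classical
namespace Summit.CriticalPhenomena.PercolationContinuityZ3.Theorems

namespace SahiDeepCore

open Literature.Combinatorics.Sahi2008
open Literature.Probability.Percolation.DecisionTree (ind ind_of_mem ind_of_not_mem ind_nonneg)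
open Finset

variable {ι : Type} [Fintype ι]

local notation3 (prettyPrint := false) "m⟦" p ", " X "⟧" => ex (bernoulliWeight p) (ind X)
/-! ### 1. Cell bookkeeping for a sunflower -/

omit [Fintype ι] in
/-- Cell masses are nonnegative. [folklore] -/
private theorem massD_nonneg [Fintype ι] (p : ι → unitInterval) (X : Set (Set ι)) : 0 ≤ m⟦p, X⟧ :=
  ex_nonneg (isFKGMeasure_bernoulliWeight p).nonneg fun ω => ind_nonneg _ ω

omit [Fintype ι] in
/-- `1_X = 1_{X ∩ Y} + 1_{X ∖ Y}`. [folklore] -/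
private theorem indD_split (X Y : Set (Set ι)) : ind X = ind (X ∩ Y) + ind (X \ Y) := by
  funext ω
  simp only [Pi.add_apply]
  by_cases hX : ω ∈ X
  · by_cases hY : ω ∈ Y
    · rw [ind_of_mem hX, ind_of_mem (show ω ∈ X ∩ Y from ⟨hX, hY⟩), ind_of_not_mem (show ω ∉ X \ Y from fun h => h.2 hY)]
      norm_num
    · rw [ind_of_mem hX, ind_of_not_mem (show ω ∉ X ∩ Y from fun h => hY h.2), ind_of_mem (show ω ∈ X \ Y from ⟨hX, hY⟩)]
      norm_num
  · rw [ind_of_not_mem hX, ind_of_not_mem (show ω ∉ X ∩ Y from fun h => hX h.1),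
      ind_of_not_mem (show ω ∉ X \ Y from fun h => hX h.1)]
    norm_num

/-- `μ(X) = μ(X ∩ Y) + μ(X ∖ Y)`. [folklore] -/
private theorem massD_split (p : ι → unitInterval) (X Y : Set (Set ι)) : m⟦p, X⟧ = m⟦p, X ∩ Y⟧ + m⟦p, X \ Y⟧ := by
  have h := congrArg (ex (bernoulliWeight p)) (indD_split X Y)
  rwa [ex_add] at h

/-- `ex` is additive over finite sums. [folklore] -/
private theorem exD_sum {α : Type} [Fintype α] (μ : α → ℝ) {β : Type} (s : Finset β) (f : β → α → ℝ) :
    ex μ (∑ b ∈ s, f b) = ∑ b ∈ s, ex μ (f b) := by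
  induction s using Finset.induction_on with
  | empty =>
    simp only [sum_empty]
    show ∑ x, μ x * (0 : α → ℝ) x = 0
    simp
  | insert b s hb ih => rw [sum_insert hb, sum_insert hb, ex_add, ih]

/-- In a sunflower with `≥ 2` members: `μ(U_i) = μ(K) + μ(U_i ∖ K)`. [this work] -/
theorem mass_member_eq {k : ℕ} (p : ι → unitInterval) {U : Fin k → Set (Set ι)} {K : Set (Set ι)}
    (hK : IsSunflower U K) {i j : Fin k} (hij : i ≠ j) : m⟦p, U i⟧ = m⟦p, K⟧ + m⟦p, U i \ K⟧ := by
  rw [massD_split p (U i) K, Set.inter_eq_right.2 (kernel_subset_of_isSunflower hK hij)]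

omit [Fintype ι] in
/-- In a sunflower with `≥ 2` members: `D_i ∖ O = U_i ∖ K`. [this work] -/
theorem petalDown_diff_outside {k : ℕ} {U : Fin k → Set (Set ι)} {K : Set (Set ι)} (hK : IsSunflower U K)
    {i j : Fin k} (hij : i ≠ j) : petalDown U i \ outside U = U i \ K := by
  ext ω
  simp only [petalDown, outside, Set.mem_sdiff, Set.mem_setOf_eq, not_forall, not_not]
  constructor
  · rintro ⟨hD, ⟨l, hl⟩⟩
    have hli : l = i := by
      by_contra h
      exact hD l h hl
    subst hli
    refine ⟨hl, fun hω => hD j (Ne.symm hij) ?_⟩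
    exact kernel_subset_of_isSunflower hK (Ne.symm hij) hω
  · rintro ⟨hUi, hKn⟩
    refine ⟨fun l hl hω => hKn ?_, ⟨i, hUi⟩⟩
    rw [← hK i l (Ne.symm hl)]
    exact ⟨hUi, hω⟩

/-- In a sunflower with `≥ 2` members: `μ(D_i) = μ(O) + μ(U_i ∖ K)`. [this work] -/
theorem mass_petalDown_eq {k : ℕ} (p : ι → unitInterval) {U : Fin k → Set (Set ι)} {K : Set (Set ι)}
    (hK : IsSunflower U K) {i j : Fin k} (hij : i ≠ j) :
    m⟦p, petalDown U i⟧ = m⟦p, outside U⟧ + m⟦p, U i \ K⟧ := by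
  have hO : petalDown U i ∩ outside U = outside U := by
    ext ω
    simp only [petalDown, outside, Set.mem_inter_iff, Set.mem_setOf_eq]
    exact ⟨fun h => h.2, fun h => ⟨fun l _ => h l, h⟩⟩
  rw [massD_split p (petalDown U i) (outside U), petalDown_diff_outside hK hij, hO]

omit [Fintype ι] in
/-- The cells `K`, `O`, `U_i ∖ K` partition the cube (pointwise identity of indicators). [this work] -/
theorem ind_sunflowerCells_sum {k : ℕ} {U : Fin k → Set (Set ι)} {K : Set (Set ι)} (hK : IsSunflower U K)
    {i0 j0 : Fin k} (h01 : i0 ≠ j0) :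
    ind K + ind (outside U) + ∑ i, ind (U i \ K) = fun _ => (1 : ℝ) := by
  have hKsub : ∀ i, K ⊆ U i := by
    intro i
    by_cases hi : i = i0
    · subst hi; exact kernel_subset_of_isSunflower hK h01
    · exact kernel_subset_of_isSunflower hK hi
  funext ω
  simp only [Pi.add_apply, Finset.sum_apply]
  by_cases hω : ω ∈ K
  · rw [ind_of_mem hω, ind_of_not_mem (show ω ∉ outside U from fun h => h i0 (hKsub i0 hω))]
    rw [Finset.sum_eq_zero fun i _ => ind_of_not_mem (show ω ∉ U i \ K from fun h => h.2 hω)]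
    norm_num
  · rw [ind_of_not_mem hω]
    by_cases hO : ω ∈ outside U
    · rw [ind_of_mem hO, Finset.sum_eq_zero fun i _ => ind_of_not_mem (show ω ∉ U i \ K from fun h => hO i h.1)]
      norm_num
    · rw [ind_of_not_mem hO]
      simp only [outside, Set.mem_setOf_eq, not_forall, not_not] at hO
      obtain ⟨i, hi⟩ := hO
      rw [Finset.sum_eq_single i (fun l _ hl => ind_of_not_mem (show ω ∉ U l \ K from fun h => hω ?_))
        (fun h => absurd (Finset.mem_univ i) h), ind_of_mem (show ω ∈ U i \ K from ⟨hi, hω⟩)]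
      · norm_num
      · rw [← hK l i hl]; exact ⟨h.1, hi⟩

/-- `μ(K) + μ(O) + Σ_i μ(U_i ∖ K) = 1`. [this work] -/
theorem mass_sunflowerCells_sum {k : ℕ} (p : ι → unitInterval) {U : Fin k → Set (Set ι)} {K : Set (Set ι)} (hK : IsSunflower U K)
    {i0 j0 : Fin k} (h01 : i0 ≠ j0) :
    m⟦p, K⟧ + m⟦p, outside U⟧ + ∑ i, m⟦p, U i \ K⟧ = 1 := by
  have h := congrArg (ex (bernoulliWeight p)) (ind_sunflowerCells_sum hK h01)
  rw [ex_add, ex_add, exD_sum, ex_const (sum_bernoulliWeight p)] at h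
  exact h

/-! ### 2. Measure level: the smaller hub's branch implies the larger hub's branch -/

/-- Padding of the petal masses to a sequence on `ℕ`. [this work] -/
private theorem cellsD_range {k : ℕ} (p : ι → unitInterval) (U : Fin k → Set (Set ι)) (K : Set (Set ι)) (t : ℝ) :
    (∏ i : Fin k, (t + m⟦p, U i \ K⟧)) =
      ∏ n ∈ range k, (t + (fun n => if h : n < k then m⟦p, U ⟨n, h⟩ \ K⟧ else 0) n) := by
  rw [← Fin.prod_univ_eq_prod_range]
  refine Finset.prod_congr rfl fun i _ => ?_
  simp only [Fin.is_lt, dif_pos, Fin.eta]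

/-- Padding of the petal masses to a sequence on `ℕ` (sum form). [this work] -/
private theorem cellsD_range_sum {k : ℕ} (p : ι → unitInterval) (U : Fin k → Set (Set ι)) (K : Set (Set ι)) :
    (∑ i : Fin k, m⟦p, U i \ K⟧) = ∑ n ∈ range k, (fun n => if h : n < k then m⟦p, U ⟨n, h⟩ \ K⟧ else 0) n := by
  rw [← Fin.sum_univ_eq_sum_range]
  refine Finset.sum_congr rfl fun i _ => ?_
  simp only [Fin.is_lt, dif_pos, Fin.eta]

/-- **Outside branch ⟹ kernel branch when `0 < μ(O) ≤ μ(K)`** (`k ≥ 2`). [this work] -/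
theorem kernel_branch_of_outside_branch {k : ℕ} (hk : 2 ≤ k) (p : ι → unitInterval) {U : Fin k → Set (Set ι)}
    {K : Set (Set ι)} (hK : IsSunflower U K) (hpos : 0 < m⟦p, outside U⟧) (hle : m⟦p, outside U⟧ ≤ m⟦p, K⟧)
    (hout : ∏ i, m⟦p, petalDown U i⟧ ≤ m⟦p, outside U⟧ ^ (k - 1)) : ∏ i, m⟦p, U i⟧ ≤ m⟦p, K⟧ ^ (k - 1) := by
  set i0 : Fin k := ⟨0, by omega⟩ with hi0
  set i1 : Fin k := ⟨1, by omega⟩ with hi1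
  have h01 : i0 ≠ i1 := by intro h; have := congrArg Fin.val h; simp [hi0, hi1] at this
  have hne : ∀ i : Fin k, ∃ j, i ≠ j := fun i => by
    by_cases hi : i = i0
    · exact ⟨i1, hi ▸ h01⟩
    · exact ⟨i0, hi⟩
  set c : ℕ → ℝ := fun n => if h : n < k then m⟦p, U ⟨n, h⟩ \ K⟧ else 0 with hc_def
  have hc : ∀ n, 0 ≤ c n := fun n => by
    simp only [hc_def]; split_ifs
    · exact massD_nonneg p _
    · exact le_rfl
  have hU_eq : ∏ i, m⟦p, U i⟧ = ∏ n ∈ range k, (m⟦p, K⟧ + c n) := by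
    rw [← cellsD_range p U K]
    exact Finset.prod_congr rfl fun i _ => by obtain ⟨j, hij⟩ := hne i; exact mass_member_eq p hK hij
  have hD_eq : ∏ i, m⟦p, petalDown U i⟧ = ∏ n ∈ range k, (m⟦p, outside U⟧ + c n) := by
    rw [← cellsD_range p U K]
    exact Finset.prod_congr rfl fun i _ => by obtain ⟨j, hij⟩ := hne i; exact mass_petalDown_eq p hK hij
  have hsum : ∑ n ∈ range k, c n = 1 - m⟦p, outside U⟧ - m⟦p, K⟧ := by
    rw [← cellsD_range_sum p U K]
    have := mass_sunflowerCells_sum p hK h01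
    linarith
  rw [hU_eq]
  rw [hD_eq] at hout
  exact prod_add_le_pow_of_prod_add_le_pow c hc hpos hle hk hsum hout

/-- **Kernel branch ⟹ outside branch when `0 < μ(K) ≤ μ(O)`** (`k ≥ 2`). [this work] -/
theorem outside_branch_of_kernel_branch {k : ℕ} (hk : 2 ≤ k) (p : ι → unitInterval) {U : Fin k → Set (Set ι)}
    {K : Set (Set ι)} (hK : IsSunflower U K) (hpos : 0 < m⟦p, K⟧) (hle : m⟦p, K⟧ ≤ m⟦p, outside U⟧)
    (hker : ∏ i, m⟦p, U i⟧ ≤ m⟦p, K⟧ ^ (k - 1)) : ∏ i, m⟦p, petalDown U i⟧ ≤ m⟦p, outside U⟧ ^ (k - 1) := by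
  set i0 : Fin k := ⟨0, by omega⟩ with hi0
  set i1 : Fin k := ⟨1, by omega⟩ with hi1
  have h01 : i0 ≠ i1 := by intro h; have := congrArg Fin.val h; simp [hi0, hi1] at this
  have hne : ∀ i : Fin k, ∃ j, i ≠ j := fun i => by
    by_cases hi : i = i0
    · exact ⟨i1, hi ▸ h01⟩
    · exact ⟨i0, hi⟩
  set c : ℕ → ℝ := fun n => if h : n < k then m⟦p, U ⟨n, h⟩ \ K⟧ else 0 with hc_def
  have hc : ∀ n, 0 ≤ c n := fun n => by
    simp only [hc_def]; split_ifs
    · exact massD_nonneg p _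
    · exact le_rfl
  have hU_eq : ∏ i, m⟦p, U i⟧ = ∏ n ∈ range k, (m⟦p, K⟧ + c n) := by
    rw [← cellsD_range p U K]
    exact Finset.prod_congr rfl fun i _ => by obtain ⟨j, hij⟩ := hne i; exact mass_member_eq p hK hij
  have hD_eq : ∏ i, m⟦p, petalDown U i⟧ = ∏ n ∈ range k, (m⟦p, outside U⟧ + c n) := by
    rw [← cellsD_range p U K]
    exact Finset.prod_congr rfl fun i _ => by obtain ⟨j, hij⟩ := hne i; exact mass_petalDown_eq p hK hij
  have hsum : ∑ n ∈ range k, c n = 1 - m⟦p, K⟧ - m⟦p, outside U⟧ := by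
    rw [← cellsD_range_sum p U K]
    have := mass_sunflowerCells_sum p hK h01
    linarith
  rw [hD_eq]
  rw [hU_eq] at hker
  exact prod_add_le_pow_of_prod_add_le_pow c hc hpos hle hk hsum hker

/-! ### 3. The plain dichotomy at all levels `≤ k` gives `SunflowerOnePayer k` (degenerate hubs by member deletion) -/

/-- Masses are monotone under inclusion. [folklore] -/
private theorem massD_mono (p : ι → unitInterval) {X Y : Set (Set ι)} (h : X ⊆ Y) : m⟦p, X⟧ ≤ m⟦p, Y⟧ := by
  refine ex_mono (isFKGMeasure_bernoulliWeight p).nonneg fun ω => ?_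
  by_cases hX : ω ∈ X
  · rw [ind_of_mem hX, ind_of_mem (h hX)]
  · rw [ind_of_not_mem hX]; exact ind_nonneg _ ω

/-- Masses are at most `1`. [folklore] -/
private theorem massD_le_one (p : ι → unitInterval) (X : Set (Set ι)) : m⟦p, X⟧ ≤ 1 := by
  calc m⟦p, X⟧ ≤ ex (bernoulliWeight p) (fun _ => (1 : ℝ)) := by
        refine ex_mono (isFKGMeasure_bernoulliWeight p).nonneg fun ω => ?_
        by_cases hX : ω ∈ X
        · rw [ind_of_mem hX]
        · rw [ind_of_not_mem hX]; norm_num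
    _ = 1 := ex_const (sum_bernoulliWeight p) 1

omit [Fintype ι] in
/-- Deleting a member of a sunflower leaves a sunflower with the same kernel. [this work] -/
theorem isSunflower_succAbove {k : ℕ} {U : Fin (k + 1) → Set (Set ι)} {K : Set (Set ι)} (hK : IsSunflower U K)
    (i : Fin (k + 1)) : IsSunflower (fun j => U (i.succAbove j)) K :=
  fun _ _ hjl => hK _ _ fun h => hjl (Fin.succAbove_right_injective h)

omit [Fintype ι] in
/-- After deleting member `i` the outside is the old complementary down-set `D_i`. [this work] -/
theorem outside_succAbove {k : ℕ} (U : Fin (k + 1) → Set (Set ι)) (i : Fin (k + 1)) :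
    outside (fun j => U (i.succAbove j)) = petalDown U i := by
  ext ω
  simp only [outside, petalDown, Set.mem_setOf_eq]
  constructor
  · intro h l hl
    obtain ⟨j, rfl⟩ := Fin.exists_succAbove_eq hl
    exact h j
  · intro h j
    exact h _ (Fin.succAbove_ne i j)

omit [Fintype ι] in
/-- After deleting member `i` the complementary down-sets can only grow. [this work] -/
theorem petalDown_subset_succAbove {k : ℕ} (U : Fin (k + 1) → Set (Set ι)) (i : Fin (k + 1)) (j : Fin k) :
    petalDown U (i.succAbove j) ⊆ petalDown (fun l => U (i.succAbove l)) j := by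
  intro ω h l hl
  exact h _ fun h' => hl (Fin.succAbove_right_injective h')

/-- **The plain dichotomy at every level `2 ≤ j ≤ k` implies `SunflowerOnePayer k p`.**  Non-degenerate hubs: the
transfer lemma (§2).  Degenerate hub (`μ(O) = 0`, say) with only the outside branch available: some `μ(D_i) = 0`, hence
`μ(U_i) = μ(K)`; delete member `i` (a `(k−1)`-sunflower with kernel `K` and outside `D_i` of mass `0 ≤ μ(K)`) and use the
level-`(k−1)` statement obtained inductively. [this work] -/
theorem sunflowerOnePayer_of_dichotomy (p : ι → unitInterval) :
    ∀ k : ℕ, (∀ j, 2 ≤ j → j ≤ k → ∀ (U : Fin j → Set (Set ι)) (K : Set (Set ι)), (∀ i, IsUpperSet (U i)) →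
        IsSunflower U K → (∏ i, m⟦p, U i⟧ ≤ m⟦p, K⟧ ^ (j - 1) ∨
          ∏ i, m⟦p, petalDown U i⟧ ≤ m⟦p, outside U⟧ ^ (j - 1))) → SunflowerOnePayer k p := by
  intro k
  induction k with
  | zero =>
    intro _ U K _ _
    refine ⟨fun _ => ?_, fun _ => ?_⟩ <;> simp
  | succ k ih =>
    intro hdich U K hU hK
    -- the level-`k` statement from the dichotomy at levels `≤ k`
    have hk' : SunflowerOnePayer k p := ih fun j hj hjk => hdich j hj (Nat.le_succ_of_le hjk)
    rcases Nat.lt_or_ge k 1 with hk0 | hk1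
    · -- `k = 0`: one member, exponent `0`
      have hk0' : k = 0 := by omega
      subst hk0'
      refine ⟨fun _ => ?_, fun _ => ?_⟩
      · rw [Fin.prod_univ_one, show (0 + 1 - 1 : ℕ) = 0 from rfl, pow_zero]; exact massD_le_one p _
      · rw [Fin.prod_univ_one, show (0 + 1 - 1 : ℕ) = 0 from rfl, pow_zero]; exact massD_le_one p _
    rcases Nat.lt_or_ge k 2 with hk1' | hk2
    · -- `k = 1`: two members, Harris
      have hk1'' : k = 1 := by omega
      subst hk1''
      exact sunflowerOnePayer_two p U K hU hK
    -- `k ≥ 2`: `k + 1 ≥ 3` members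
    have hexp : k + 1 - 1 = (k - 1) + 1 := by omega
    have hd := hdich (k + 1) (by omega) le_rfl U K hU hK
    refine ⟨fun hle => ?_, fun hle => ?_⟩
    · -- kernel half: `μ(O) ≤ μ(K)`
      rcases hd with hker | hout
      · exact hker
      by_cases hpos : 0 < m⟦p, outside U⟧
      · exact kernel_branch_of_outside_branch (by omega) p hK hpos hle hout
      · have hO0 : m⟦p, outside U⟧ = 0 := le_antisymm (not_lt.1 hpos) (massD_nonneg p _)
        rw [hO0, hexp, pow_succ, mul_zero] at hout
        have hz : ∏ i, m⟦p, petalDown U i⟧ = 0 :=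
          le_antisymm hout (Finset.prod_nonneg fun i _ => massD_nonneg p _)
        obtain ⟨i, _, hi⟩ := Finset.prod_eq_zero_iff.1 hz
        -- `μ(U_i ∖ K) = 0`, so `μ(U_i) = μ(K)`
        obtain ⟨j, hij⟩ : ∃ j, i ≠ j := by
          by_cases h : i = ⟨0, by omega⟩
          · exact ⟨⟨1, by omega⟩, by rw [h]; exact fun h' => by have := congrArg Fin.val h'; simp at this⟩
          · exact ⟨⟨0, by omega⟩, h⟩
        have hCi : m⟦p, U i \ K⟧ = 0 := by
          refine le_antisymm ?_ (massD_nonneg p _)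
          calc m⟦p, U i \ K⟧ ≤ m⟦p, petalDown U i⟧ := by
                rw [← petalDown_diff_outside hK hij]; exact massD_mono p fun _ hx => hx.1
            _ = 0 := hi
        have hUi : m⟦p, U i⟧ = m⟦p, K⟧ := by rw [mass_member_eq p hK hij, hCi, add_zero]
        -- delete member `i`
        set V : Fin k → Set (Set ι) := fun l => U (i.succAbove l) with hV
        have hVup : ∀ l, IsUpperSet (V l) := fun l => hU _
        have hVK : IsSunflower V K := isSunflower_succAbove hK i
        have hVO : m⟦p, outside V⟧ ≤ m⟦p, K⟧ := by
          rw [hV, outside_succAbove U i, hi]; exact massD_nonneg p _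
        have hVker := (hk' V K hVup hVK).1 hVO
        rw [Fin.prod_univ_succAbove _ i, hUi, hexp, pow_succ']
        exact mul_le_mul_of_nonneg_left hVker (massD_nonneg p _)
    · -- outside half: `μ(K) ≤ μ(O)`
      rcases hd with hker | hout
      swap
      · exact hout
      by_cases hpos : 0 < m⟦p, K⟧
      · exact outside_branch_of_kernel_branch (by omega) p hK hpos hle hker
      · have hK0 : m⟦p, K⟧ = 0 := le_antisymm (not_lt.1 hpos) (massD_nonneg p _)
        rw [hK0, hexp, pow_succ, mul_zero] at hker
        have hz : ∏ i, m⟦p, U i⟧ = 0 :=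
          le_antisymm hker (Finset.prod_nonneg fun i _ => massD_nonneg p _)
        obtain ⟨i, _, hi⟩ := Finset.prod_eq_zero_iff.1 hz
        obtain ⟨j, hij⟩ : ∃ j, i ≠ j := by
          by_cases h : i = ⟨0, by omega⟩
          · exact ⟨⟨1, by omega⟩, by rw [h]; exact fun h' => by have := congrArg Fin.val h'; simp at this⟩
          · exact ⟨⟨0, by omega⟩, h⟩
        have hCi : m⟦p, U i \ K⟧ = 0 := by
          refine le_antisymm ?_ (massD_nonneg p _)
          calc m⟦p, U i \ K⟧ ≤ m⟦p, U i⟧ := massD_mono p fun _ hx => hx.1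
            _ = 0 := hi
        have hDi : m⟦p, petalDown U i⟧ = m⟦p, outside U⟧ := by rw [mass_petalDown_eq p hK hij, hCi, add_zero]
        set V : Fin k → Set (Set ι) := fun l => U (i.succAbove l) with hV
        have hVup : ∀ l, IsUpperSet (V l) := fun l => hU _
        have hVK : IsSunflower V K := isSunflower_succAbove hK i
        have hVO : outside V = petalDown U i := by rw [hV, outside_succAbove U i]
        have hVhyp : m⟦p, K⟧ ≤ m⟦p, outside V⟧ := by rw [hK0]; exact massD_nonneg p _
        have hVout := (hk' V K hVup hVK).2 hVhyp
        rw [hVO, hDi] at hVout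
        rw [Fin.prod_univ_succAbove _ i, hDi, hexp, pow_succ']
        refine mul_le_mul_of_nonneg_left (le_trans ?_ hVout) (massD_nonneg p _)
        exact Finset.prod_le_prod (fun l _ => massD_nonneg p _) fun l _ => massD_mono p (petalDown_subset_succAbove U i l)

/-- **`(∀ k, SunflowerOnePayer k p) ↔` the plain dichotomy "kernel pays or outside pays" for every sunflower of every size.**
(`→` is gen 22's `sunflowerOnePayer_dichotomy`.)  So the typed conjecture IS the bare disjunction; equivalently the single
symmetric inequality `Π_i max(μ(U_i), μ(D_i)) ≤ max(μ(K), μ(O))^{k−1}`. [this work] -/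
theorem sunflowerOnePayer_all_iff_dichotomy_all (p : ι → unitInterval) :
    (∀ k, SunflowerOnePayer k p) ↔
      ∀ k (U : Fin k → Set (Set ι)) (K : Set (Set ι)), (∀ i, IsUpperSet (U i)) → IsSunflower U K →
        (∏ i, m⟦p, U i⟧ ≤ m⟦p, K⟧ ^ (k - 1) ∨ ∏ i, m⟦p, petalDown U i⟧ ≤ m⟦p, outside U⟧ ^ (k - 1)) :=
  ⟨fun h k U K hU hK => sunflowerOnePayer_dichotomy p (h k) U K hU hK,
    fun h k => sunflowerOnePayer_of_dichotomy p k fun j _ _ U K hU hK => h j U K hU hK⟩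

/-- Level-`k` form: `SunflowerOnePayer k p ↔` the dichotomy at all levels `2 ≤ j ≤ k`. [this work] -/
theorem sunflowerOnePayer_iff_dichotomy_le (p : ι → unitInterval) (k : ℕ) :
    SunflowerOnePayer k p ↔
      ∀ j, 2 ≤ j → j ≤ k → ∀ (U : Fin j → Set (Set ι)) (K : Set (Set ι)), (∀ i, IsUpperSet (U i)) →
        IsSunflower U K → (∏ i, m⟦p, U i⟧ ≤ m⟦p, K⟧ ^ (j - 1) ∨
          ∏ i, m⟦p, petalDown U i⟧ ≤ m⟦p, outside U⟧ ^ (j - 1)) :=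
  ⟨fun h _ hj hjk U K hU hK => sunflowerOnePayer_dichotomy p (sunflowerOnePayer_of_le p hj hjk h) U K hU hK,
    fun h => sunflowerOnePayer_of_dichotomy p k h⟩

end SahiDeepCore

end Summit.CriticalPhenomena.PercolationContinuityZ3.Theorems

end
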